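import Mathlib
import HarnessLib
import HarnessLib.Audit
import Summits.PneNP.Statement
import Literature.Computability.Complexity.ApproximateCounting
import Literature.Computability.Complexity.GraphEncodings
import HarnessLib.Audit.Status.Attr

/-!
Route: BISOrderDimension

DORMANT since 2026-08-22T16:39:38Z (reconciler: no traction for 5.5 d (last activity item-evidence-added at 2026-08-17T04:18:15Z); parked, not closed — `ledger route dormant route-PneNP-BISOrderDimension --off` to reactivate) — unstaffed, not closed; items shared with open routes are served there. `ledger route dormant <id> --off` reactivates.

Thesis X (it suffices to show) — "Dedekind's problem is hard to approximate": there is no FPRAS for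
#IDEALS, the number of subsets I ⊆ [n] closed under the implications i → j of an n × n matrix M (M i
j ≠ 0, i ∈ I ⇒ j ∈ I) — equivalently the number of down-sets (= antichains) of a finite order,
#DownSets = #1P1NSAT, the generic complete problem of Dyer–Goldberg–Greenhill–Jerrum's class #RHΠ₁
and AP-equivalent to #BIS [DyerEtAl2003, Thm 5 and Lemma 9]. Realises idea card
PneNP/PneNP/bis-order-dimension-lozenge; the sibling card bis-random-field-criticality states the
same conjecture in its #BIS form.
Lean (one line, all constants exist; FPRAS inlined in the oracle-free shape of
`Literature.Computability.Complexity.stockmeyerApproxCounting` — coins in the query, accuracy 1+1/kη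
and confidence 1−1/kδ in unary):
¬ ∃ F ∈ Literature.Computability.Complexity.FP, ∃ c : Polynomial ℕ, ∀ (x : List Bool) (kη kδ : ℕ), 0
< kη → 0 < kδ → Literature.Computability.Complexity.uniformProb (c.eval (x.length + kη + kδ)) {u | ¬
Literature.Computability.Complexity.IsApproxCount kη ((fun y : List Bool =>
(Literature.Computability.Complexity.encodingNatMatrix.decode y).elim 0 fun p => Set.ncard {I :
Finset (Fin p.1) | ∀ i ∈ I, ∀ j : Fin p.1, p.2 i j ≠ 0 → j ∈ I}) x)
(Literature.Computability.Complexity.countEstimate F x 0 kη kδ u)} ≤ 1 / (kδ : ℝ)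
Assembly X → PneNP rests on PROVED tree facts only: `StockMachine.stockmeyerApproxCounting_holds`
(at `Oracle.empty`), `NPRel_empty`, `FPRel_subset_FP_of_mem_FP`,
`P_bool_eq_holds`/`NP_bool_eq_holds` via `pneNP_shape_of_NP_not_subset_P`; the only new ingredient
is that the down-set relation is in P.

Rationale: WHY THIS LINE (import: approximate counting + dimension theory of orders + integrable plane
partitions). P = NP puts every #P function's Stockmeyer approximator in FP [Stockmeyer1985; tree:
StockMachine.stockmeyerApproxCounting_holds], so "no FPRAS for #IDEALS" ⇒ P ≠ NP, and #IDEALS/#BIS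
is the canonical counting problem believed hard WITHOUT being NP-hard [DyerEtAl2003] — structure,
not SAT-reductions, must carry a lower bound. The card's dial is the Dushnik–Miller DIMENSION d of
the order (input = d coordinate rows): d = 2 is in FP (decreasing-subsequence DP; [LinChen2017]); by
an explicit realizer of size 2k²−2k+4 for height-2 orders of degree k plus [CaiEtAl2016, Cor. 3]
(λ=1 > λ_c(6)), d ≤ 64 is already #BIS-complete (support item DimSixtyFourBISHard; the card's 2100
used [FurediKahn1986]). So all of #BIS-hardness is born in 3 ≤ d ≤ 64, and d = 3 carries an
integrable point: ideals of Q ⊆ [n]³ ↔ plane partitions in the box whose outer corners lie in Q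
(MacMahon/lozenge tilings = free fermions; [CohnKenyonPropp2001], [Wilson2004]); cylindrical Q =
(skew Young shape) × chain is determinantal (LGV: skew plane partitions with bounded parts) hence
exactly solvable, so hardness needs genuinely three-dimensional corner defects. Exact counting at d
= 3 is already #P-hard (support DimThreeExactSharpPHard: Schnyder realizer [Schnyder1989] +
Pl-Hol(1,2) [CaiKowalczyk2012]).
RANKED CRUXES. #2 DimThreeNoFPRAS — no FPRAS at dimension 3 (the bet; ⇒ X by the restriction glue
DimThreeToIdeals; its refutation would be a striking algorithm one dimension above the classical
DP). #3 DimThreeBISHard — FPRAS(dim 3) ⇒ FPRAS(#BIS): the cliff is exactly 2|3; attackable by gadget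
AP-reductions from degree-6 #BIS [CaiEtAl2016] through tall dim-3 orders (height-2 dim-3 orders are
containment orders of homothetic triangles — planar-like geometry: [Schnyder1989],
[ChaplickEtAl2018]). #4 DimFourBISHard — FPRAS(dim 4) ⇒ FPRAS(#BIS): dimension 4 contains every
PLANAR bipartite #BIS instance ([HartmanNewmanZiv1991] + [ChaplickEtAl2018, Prop. 6]), so this is
"planar #BIS is #BIS-hard", open ([GoldbergJerrumMcquillan2015] reach planar hardness only for
hard-core λ ≥ 312 via NP-hardness). Supports: DimThreeToIdeals (glue, restriction),
IdealsReduceToBIS ([DyerEtAl2003, L. 9]: X ≡ the #BIS conjecture), DimSixtyFourBISHard (calibration,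
CGGGJSV as explicit hypothesis), DimThreeExactSharpPHard (informal), Assembly.
DROPPED FROM THE CARD, with reasons: torpid mixing of corner-flip dynamics (true already at d = 2 —
series composition of two antichains = K_{m,m} — hence uninformative); "no determinantal FPRAS" (no
typable algorithm class; weak link to X).
KILL CRITERIA. FPRAS for #BIS or #IDEALS (¬X): route closed refuted. FPRAS at d = 3 (¬#2): route NOT
closed — restate #2 at the least hard dimension d* ∈ [4,64] (then #4 is the live crux). ¬#3 cannot
be refuted outright (implication), but an FPRAS at d = 3 makes it equivalent to ¬X.
NOT DECOMPOSED YET (depth earned later): the gadget calculus for dominance orders in ℕ³ (chains as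
weights, defect placement); the AP-reduction/FPRAS plumbing lemmas (FPRAS closed under
parsimonious-up-to-(1±1/poly) maps) that Assembly, DimThreeToIdeals, IdealsReduceToBIS and
DimSixtyFourBISHard share — provers attach them with --supports; Literature notions HasFPRAS /
APReducible / countDownsets requested as definitions so a tenure pass can restate the inlined
statements compactly.
NOVELTY (short; full text in the Novelty field): nearest prior art = structural-parameter results
for #BIS by bipartite pathwidth/degree [DyerGreenhillMuller2021], [CaiEtAl2016] and the d = 2 exact
algorithms [LinChen2017]; nothing found parametrising #BIS/#DownSets by ORDER DIMENSION or posing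
the d = 3 / planar-bipartite hardness questions; grade expected new-combination (card audit agrees).
BARRIERS (short; full text in the Barriers field): Relativization/Algebrization/NaturalProofs apply
to X and #2 by inheritance (they imply P ≠ NP) and are conceded; #3, #4 and all supports are
reductions/constructions between concrete counting problems and fall outside every catalogued class.

Novelty: Searched before claiming (2026-08-15, this session): crossref "approximate counting down-sets ideals
posets bounded dimension FPRAS" (0 relevant), "counting independent sets permutation graphs
comparability bounded dimension complexity" (→ LinChen2017 doi:10.1016/j.ipl.2017.02.002 = the d=2
end; DyerGreenhillMuller2021 doi:10.1002/rsa.21003 = bounded bipartite PATHWIDTH, the nearest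
structural-parameter result for #BIS), "BIS-hardness geometric intersection graphs approximate
counting" (0 relevant); galaxy --star pdf "#BIS-hard" (8 hits: CaiEtAl2016, Potts on expanders,
counting LLL — none by order dimension), galaxy --star all "counting antichains three-dimensional
poset" (0); lit read of DyerEtAl2003 (doi:10.1007/s00453-003-1073-y: Thm 5, Lemma 9), CaiEtAl2016
(arXiv:1311.4451: Cor. 3), ChaplickEtAl2018 (arXiv:1512.02482: Prop. 6, Cor. 1, Schnyder as Thm 1),
GoldbergJerrumMcquillan2015 (arXiv:1208.4987: planar hardness only for λ ≥ 312; PRAS for log Z);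
plus the card's own audit (refuter-novelty-audit-PneNP-PneNP-7-0: crossref ×3 + galaxy deep query,
same verdict). OpenAlex/arXiv API quota exhausted and local searchd unavailable at write time
(D-0023) — held-text sweep limited to the four papers above.
Nearest prior art: (i) the #BIS programme with bounded-degree hardness [DyerEtAl2003; CaiEtAl2016]
and its structural-parameter refinements by bipartite pathwidth [DyerGreenhillMuller2021]; (ii)
dimension theory of height-2 orders / grid-intersection graphs [Schnyder1989; Fur  [refs: 10.1016/j.ipl.2017.02.002, 10.1002/rsa.21003, 10.1007/s00453-003-1073-y:, 1311.4451, 1512.02482, 1208.4987, doi:10.1016/j.ipl.2017.02.002, doi:10.1002/rsa.21003, doi:10.1007/s00453-003-1073-y, LinChen2017, DyerGreenhillMuller2021, CaiEtAl2016, DyerEtAl2003, ChaplickEtAl2018, GoldbergJerrumMcquillan2015, Schnyder1989, FurediKahn1986, HartmanNewmanZiv1991, CohnKenyonPropp2001, Wilson2004, GoldbergJe]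

Barriers (technique_class: approximate-counting, ap-reductions, order-dimension): - Literature.Barriers.PneNP.Relativization: APPLIES by inheritance to IdealsNoFPRAS and
DimThreeNoFPRAS (each implies P ≠ NP through the relativizing Stockmeyer assembly); conceded, not
evaded — a proof of either must be non-relativizing. Does NOT apply to DimThreeBISHard,
DimFourBISHard or the supports, which are AP-reductions/constructions between two concrete counting
problems (true or false in every relativized world alike).
- Literature.Barriers.PneNP.BoundedRelativization: same scope as Relativization (inherited by X and
#2 only); conceded.
- Literature.Barriers.PneNP.Algebrization: inherited by X and #2 exactly as Relativization;
conceded. The reduction cruxes do not arithmetize anything.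
- Literature.Barriers.PneNP.NaturalProofs: not engaged — no circuit lower bound is attempted; X and
#2 are uniform statements about randomized polynomial-time transducers, and the rungs are
reductions. (If one tried to prove #2 via circuit lower bounds for the dim-3 counting function the
barrier would bite as usual.)
- Literature.Barriers.PneNP.LatticeGapCoNP: the analogous 'hardness without NP-hardness' pattern is
the whole point of the #BIS class — #IDEALS is not expected to be NP-hard to approximate
(DyerEtAl2003), so SAT-gadget NP-hardness reductions cannot prove X; the route's bet is that order
dimension + the integrable d=3 point give structure where reductions FROM #BIS (cruxes #3, #4) and,
eventually, direct arguments can work. The barrier's formal content (GapSVP ∈ coNP) is a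

History (route lifecycle, newest last):
- 2026-08-16T02:17:40Z · AUTO-CRUX: 1 conjecture-grade item(s) promoted to crux (IdealsReduceToBIS) — refuter vetting / tiering apply (operator:999:1362873)
- 2026-08-16T04:13:47Z · AUTO-CRUX (backfill): IdealsNoFPRAS — hypotheses of the deciding theorem that nothing in the route derives are cruxes (operator:999:1085951)
- 2026-08-22T16:39:38Z · DORMANT — reconciler: no traction for 5.5 d (last activity item-evidence-added at 2026-08-17T04:18:15Z); parked, not closed — `ledger route dormant route-PneNP-BISOrderDi (operator:999:2868278)

sub-problem: PneNP · status: dormant · opened planner-plancard-PneNP-PneNP-bis-order-dimens-c2c7ea4e-0 2026-08-15T11:00:47Z · rev 2 · ledger route-PneNP-BISOrderDimension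
GENERATED by the gate from the ledger (D-0016/17). Provers cite these decls: `theorem foo : Summit.PneNP.PneNP.Theses.BISOrderDimension.<Decl> := …` in Summits/PneNP/PneNP/Theorems/<Name>.lean.
-/

namespace Summit.PneNP.PneNP.Theses.BISOrderDimension

open scoped BigOperators Topology Manifold Classical MeasureTheory ProbabilityTheory Matrix InnerProductSpace ComplexConjugate ContinuousMap
open Filter Set Function TopologicalSpace MeasureTheory

attribute [summit_statement] _root_.PneNP

open Literature.PNP

/-- item stmt-PneNP-2091 · crux (kind.auto-crux: conjecture-grade) · rank 0 · open · by planner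
why it might fail: An FPRAS for #DownSets (≡_AP #BIS, DyerEtAl2003 Thm 5) may simply exist: #BIS has no NP-hardness backstop, only the failure of every known technique plus #RHΠ₁-completeness. And X is an unconditional randomized lower bound (⇒ P≠NP): relativization/algebrization inherited, not evaded.
sources: DyerEtAl2003, Thm 5 (preprint p. 10) and Lemma 9 (p. 13); lit paper:doi-10-1007-s00453-003-1073-y, Stockmeyer1985 — inlined FPRAS shape = Literature.Computability.Complexity.stockmeyerApproxCounting at Oracle.empty (ApproximateCounting.lean:132), ProvanBall1983 (exact #P-completeness of counting antichains / bipartite independent sets)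
[target] Dedekind's problem is hard to approximate: no FPRAS for #IDEALS — the number of subsets I ⊆
[n] closed under the implications i→j (M i j ≠ 0) of an n×n ℕ-matrix decoded by `encodingNatMatrix`
(= #DownSets of the generated preorder = #1P1NSAT, the generic complete problem of #RHΠ₁;
AP-equivalent to #BIS by DyerEtAl2003 Thm 5 / Lemma 9, so this IS the #BIS conjecture in Dedekind's
clothing). FPRAS is inlined in the oracle-free shape of `stockmeyerApproxCounting`: ∃ F ∈ FP, ∃ c,
for all x, kη, kδ > 0, all but a 1/kδ fraction of coin strings u ∈ {0,1}^{c(|x|+kη+kδ)} make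
`countEstimate F x 0 kη kδ u` a (1+1/kη)-approximation (equivalent to the textbook FPRAS by median
amplification). Undecodable inputs count 0. Shared in substance with sibling card
bis-random-field-criticality (their X = no FPRAS for #BIS; see support IdealsReduceToBIS). -/
@[route_item "route-PneNP-BISOrderDimension", crux]
def IdealsNoFPRAS : Prop :=
  ¬ ∃ F ∈ Literature.Computability.Complexity.FP, ∃ c : Polynomial ℕ, ∀ (x : List Bool) (kη kδ : ℕ), 0 < kη → 0 < kδ → Literature.Computability.Complexity.uniformProb (c.eval (x.length + kη + kδ)) {u | ¬ Literature.Computability.Complexity.IsApproxCount kη ((fun y : List Bool => (Literature.Computability.Complexity.encodingNatMatrix.decode y).elim 0 fun p => Set.ncard {I : Finset (Fin p.1) | ∀ i ∈ I, ∀ j : Fin p.1, p.2 i j ≠ 0 → j ∈ I}) x) (Literature.Computability.Complexity.countEstimate F x 0 kη kδ u)} ≤ 1 / (kδ : ℝ)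

/-- item stmt-PneNP-2092 · crux · rank 2 · open · by planner
why it might fail: d=3 may admit an FPRAS: the dim-3 subclasses located so far are easy — skew-shape×chain is determinantal (LGV); planar incidence posets (dim≤3, Schnyder) count Z_(1,2,1), ferro 2-spin with an FPRAS on ALL graphs (GJP2003 via GJM2015 p.4); d=2 is linear time (LinChen2017). And it implies P≠NP.
sources: GoldbergJerrumPaterson2003 — FPRAS for ferromagnetic 2-spin with β≤γ, λ≥√(β/γ); as quoted in GoldbergJerrumMcquillan2015 §1.1 (lit paper:arxiv-1208.4987 p. 4), Schnyder1989; ChaplickEtAl2018 Thm 1 and Cor. 1 (lit paper:arxiv-1512.02482 pp. 7–8: G planar ⇔ dim P_G ≤ 3; 3-DORG ⇒ dim ≤ 3), DyerEtAl2003, Thm 5 / Lemma 9 (#DownSets ≡_AP #BIS; lit paper:doi-10-1007-s00453-003-1073-y pp. 10, 13), LinChen2017 (doi:10.1016/j.ipl.2017.02.002: the d = 2 end — independent sets of bipartite permutation graphs in linear time), CohnKenyonPropp2001; Wilson2004 (integrable undefected box: limit shape, polynomial mixing of lozenge dynamics)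
[crux] No FPRAS for counting down-sets of 3-DIMENSIONAL orders: input an n×n ℕ-matrix whose rows
0,1,2 are coordinates, j ≤ i iff M k j ≤ M k i for k < 3 (every order of Dushnik–Miller dimension ≤
3 arises; coordinates given = strongest algorithmic access). By the corner-defect bijection (ideals
I of Q ⊆ [n]^3 ↔ ideals ↓I of the box all of whose maximal elements lie in Q) this is MacMahon's
boxed-plane-partition / lozenge free-fermion model with local corner defects; cylindrical Q = (skew
Young shape) × chain stays determinantal (LGV, skew plane partitions with bounded parts) and exactly
solvable, so the content is in genuinely three-dimensional defects. The route's bet (card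
bis-order-dimension-lozenge): the easy/hard cliff for Dedekind-type counting is 2|3. ⇒ target via
DimThreeToIdeals. A refutation (an FPRAS one dimension above the classical decreasing-subsequence
DP, LinChen2017) would itself be a striking algorithm and moves the crux to the least hard dimension
d* ∈ [4,64]. -/
@[route_item "route-PneNP-BISOrderDimension"]
def DimThreeNoFPRAS : Prop :=
  ¬ ∃ F ∈ Literature.Computability.Complexity.FP, ∃ c : Polynomial ℕ, ∀ (x : List Bool) (kη kδ : ℕ), 0 < kη → 0 < kδ → Literature.Computability.Complexity.uniformProb (c.eval (x.length + kη + kδ)) {u | ¬ Literature.Computability.Complexity.IsApproxCount kη ((fun y : List Bool => (Literature.Computability.Complexity.encodingNatMatrix.decode y).elim 0 fun p => Set.ncard {I : Finset (Fin p.1) | ∀ i ∈ I, ∀ j : Fin p.1, (∀ k : Fin p.1, k.val < 3 → p.2 k j ≤ p.2 k i) → j ∈ I}) x) (Literature.Computability.Complexity.countEstimate F x 0 kη kδ u)} ≤ 1 / (kδ : ℝ)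

/-- item stmt-PneNP-2093 · crux · rank 3 · open · by planner
why it might fail: False iff dim 3 has an FPRAS while #BIS has none: height-2 dim-3 orders are homothetic-triangle containment graphs (planar-like; the planar-incidence-poset subclass is FPRASable), known #BIS gadgets are bounded-degree bipartite expanders (CaiEtAl2016, Δ≥6), no gadget calculus for dominance in ℕ³.
sources: CaiEtAl2016, Cor. 3 (lit paper:arxiv-1311.4451 p. 5: hard-core with λ > λ_c(Δ) is #BIS-hard on bipartite graphs of maximum degree Δ; λ = 1 > λ_c(6)), DyerEtAl2003, Lemmas 8–9 (lit paper:doi-10-1007-s00453-003-1073-y pp. 12–13: chain / blow-up gadgets into and out of #DownSets), ChaplickEtAl2018 §3, Cor. 1, Prop. 9 (lit paper:arxiv-1512.02482 pp. 7–8: which height-2 classes have dimension 3; planar incidence posets = stabbable GIGs); Schnyder1989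
[crux] Dimension three is #BIS-hard: an FPRAS for down-sets of 3-dimensional orders (3 coordinate
rows, as in DimThreeNoFPRAS) yields an FPRAS for #BIS (number of independent sets of a 2-colourable
graph decoded by `encodingGraph`, 0 otherwise). Expected proof shape: an AP-reduction from #BIS on
bipartite graphs of maximum degree 6 (#BIS-hard by CaiEtAl2016 Cor. 3, λ = 1 > λ_c(6) = 3125/4096)
into TALL 3-dimensional orders using chains as weights (as in DyerEtAl2003 Lemmas 8–9), since
height-2 dim-3 orders are containment orders of homothetic triangles in the plane (Schnyder-type
geometry) and look too planar. Proving it pins the cliff at 2|3 and (with IdealsReduceToBIS,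
DimThreeToIdeals) makes DimThreeNoFPRAS EQUIVALENT to the target. Stated as an implication between
FPRAS-existence Props (house style, cf. Lattice route); the honest reading is 'exhibit the
reduction'. -/
@[route_item "route-PneNP-BISOrderDimension"]
def DimThreeBISHard : Prop :=
  (∃ F ∈ Literature.Computability.Complexity.FP, ∃ c : Polynomial ℕ, ∀ (x : List Bool) (kη kδ : ℕ), 0 < kη → 0 < kδ → Literature.Computability.Complexity.uniformProb (c.eval (x.length + kη + kδ)) {u | ¬ Literature.Computability.Complexity.IsApproxCount kη ((fun y : List Bool => (Literature.Computability.Complexity.encodingNatMatrix.decode y).elim 0 fun p => Set.ncard {I : Finset (Fin p.1) | ∀ i ∈ I, ∀ j : Fin p.1, (∀ k : Fin p.1, k.val < 3 → p.2 k j ≤ p.2 k i) → j ∈ I}) x) (Literature.Computability.Complexity.countEstimate F x 0 kη kδ u)} ≤ 1 / (kδ : ℝ)) → (∃ F ∈ Literature.Computability.Complexity.FP, ∃ c : Polynomial ℕ, ∀ (x : List Bool) (kη kδ : ℕ), 0 < kη → 0 < kδ → Literature.Computability.Complexity.uniformProb (c.eval (x.length + kη + kδ)) {u | ¬ Literature.Computability.Complexity.IsApproxCount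 kη ((fun y : List Bool => (Literature.Computability.Complexity.encodingGraph.decode y).elim 0 fun G => Set.ncard {S : Finset (Fin G.1) | G.2.Colorable 2 ∧ ∀ a ∈ S, ∀ b ∈ S, ¬ G.2.Adj a b}) x) (Literature.Computability.Complexity.countEstimate F x 0 kη kδ u)} ≤ 1 / (kδ : ℝ))

/-- item stmt-PneNP-2094 · crux · rank 4 · open · by planner
why it might fail: False iff dim 4 (⊇ all planar-bipartite and grid-intersection #BIS instances) has an FPRAS while #BIS has none: planar instances have 2^O(√n) exact algorithms and a PRAS for log Z; the one planar hardness known (hard-core λ≥312, GJM2015) uses NP-hardness of planar MIS, absent on bipartite graphs.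
sources: HartmanNewmanZiv1991 (every planar bipartite graph is a grid-intersection graph), ChaplickEtAl2018, Prop. 6 (lit paper:arxiv-1512.02482 p. 7: {L←, L→, L↑, L↓} is a realizer of every GIG, so dim ≤ 4, explicit and polynomial-time), GoldbergJerrumMcquillan2015 §1.1–1.2 (lit paper:arxiv-1208.4987 p. 4: no FPRAS for planar hard-core only for λ ≥ 312 unless NP = RP; PRAS for log Z on all planar graphs), CaiEtAl2016, Cor. 3 (lit paper:arxiv-1311.4451 p. 5: the bounded-degree source problem)
[crux] Dimension four is #BIS-hard: an FPRAS for down-sets of 4-dimensional orders (4 coordinate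
rows) yields an FPRAS for #BIS. Dimension 4 already contains EVERY PLANAR BIPARTITE #BIS instance:
planar bipartite graphs are grid-intersection graphs (HartmanNewmanZiv1991) and a GIG representation
gives an explicit 4-realizer L←, L→, L↑, L↓ (ChaplickEtAl2018 Prop. 6), both polynomial-time; so the
item follows from '#BIS restricted to planar bipartite graphs is #BIS-hard' — open:
GoldbergJerrumMcquillan2015 obtain planar hardness only for the hard-core model at λ ≥ 312 and only
via NP-hardness (planar max independent set), a mechanism unavailable inside #BIS. The intermediate
rung between DimThreeBISHard and the calibration DimSixtyFourBISHard; becomes the live crux if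
DimThreeNoFPRAS is refuted. -/
@[route_item "route-PneNP-BISOrderDimension"]
def DimFourBISHard : Prop :=
  (∃ F ∈ Literature.Computability.Complexity.FP, ∃ c : Polynomial ℕ, ∀ (x : List Bool) (kη kδ : ℕ), 0 < kη → 0 < kδ → Literature.Computability.Complexity.uniformProb (c.eval (x.length + kη + kδ)) {u | ¬ Literature.Computability.Complexity.IsApproxCount kη ((fun y : List Bool => (Literature.Computability.Complexity.encodingNatMatrix.decode y).elim 0 fun p => Set.ncard {I : Finset (Fin p.1) | ∀ i ∈ I, ∀ j : Fin p.1, (∀ k : Fin p.1, k.val < 4 → p.2 k j ≤ p.2 k i) → j ∈ I}) x) (Literature.Computability.Complexity.countEstimate F x 0 kη kδ u)} ≤ 1 / (kδ : ℝ)) → (∃ F ∈ Literature.Computability.Complexity.FP, ∃ c : Polynomial ℕ, ∀ (x : List Bool) (kη kδ : ℕ), 0 < kη → 0 < kδ → Literature.Computability.Complexity.uniformProb (c.eval (x.length + kη + kδ)) {u | ¬ Literature.Computability.Complexity.IsApproxCount kη ((fun y : List Bool => (Literature.Computability.Complexity.encodingGraph.decode y).elim 0 fun G => Set.ncard {S :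 Finset (Fin G.1) | G.2.Colorable 2 ∧ ∀ a ∈ S, ∀ b ∈ S, ¬ G.2.Adj a b}) x) (Literature.Computability.Complexity.countEstimate F x 0 kη kδ u)} ≤ 1 / (kδ : ℝ))

/-- item stmt-PneNP-2096 · crux (kind.auto-crux: conjecture-grade) · rank 9 · open · by planner
why it might fail: auto-crux — conjecture-grade statement (docstring avows it ('conjecture')); it is open, so it may simply be false
sources: DyerEtAl2003, Lemma 9 and Thm 5 (lit paper:doi-10-1007-s00453-003-1073-y pp. 10–13)
[support] DyerEtAl2003 Lemma 9 (#DownSets ≤_AP #BIS) with the cycle-collapsing remark of Thm 5: an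
FPRAS for #BIS yields an FPRAS for #IDEALS. Reduction: condense the implication digraph (SCCs) to a
partial order on [n]; blow each element i into blocks U_i, V_i of size 2n with U_i–V_j complete
whenever i ≤ j; 'full' independent sets are exactly (2^{2n}−1)^n-to-1 over down-sets and non-full
ones are a < 1/4 fraction for n ≥ 5, so dividing the #BIS estimate by (2^{2n}−1)^n and rounding
gives the count (small n by brute force). Not load-bearing for the assembly; it records that the
target is literally AP-equivalent to the #BIS conjecture of the sibling card
bis-random-field-criticality. -/
@[route_item "route-PneNP-BISOrderDimension"]
def IdealsReduceToBIS : Prop :=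
  (∃ F ∈ Literature.Computability.Complexity.FP, ∃ c : Polynomial ℕ, ∀ (x : List Bool) (kη kδ : ℕ), 0 < kη → 0 < kδ → Literature.Computability.Complexity.uniformProb (c.eval (x.length + kη + kδ)) {u | ¬ Literature.Computability.Complexity.IsApproxCount kη ((fun y : List Bool => (Literature.Computability.Complexity.encodingGraph.decode y).elim 0 fun G => Set.ncard {S : Finset (Fin G.1) | G.2.Colorable 2 ∧ ∀ a ∈ S, ∀ b ∈ S, ¬ G.2.Adj a b}) x) (Literature.Computability.Complexity.countEstimate F x 0 kη kδ u)} ≤ 1 / (kδ : ℝ)) → (∃ F ∈ Literature.Computability.Complexity.FP, ∃ c : Polynomial ℕ, ∀ (x : List Bool) (kη kδ : ℕ), 0 < kη → 0 < kδ → Literature.Computability.Complexity.uniformProb (c.eval (x.length + kη + kδ)) {u | ¬ Literature.Computability.Complexity.IsApproxCount kη ((fun y : List Bool => (Literature.Computability.Complexity.encodingNatMatrix.decode y).elim 0 fun p => Set.ncard {I : Finset (Fin p.1) | ∀ i ∈ I, ∀ j : Fin p.1, p.2 i j ≠ 0 → j ∈ I}) x) (Literature.Computability.Complexity.countEstimate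 F x 0 kη kδ u)} ≤ 1 / (kδ : ℝ))

/-- item stmt-PneNP-2095 · support · rank 9 · closed · proved by Summit.PneNP.PneNP.Theorems.bisOrderDimension_dimThreeToIdeals_proof @ 66ecb36193a5 (prover) · by planner
sources: folklore; Literature.Computability.Complexity.FPRel_subset_FP_of_mem_FP, countQuery/countEstimate (ApproximateCounting.lean)
[support] Glue DimThreeNoFPRAS → IdealsNoFPRAS (restriction): map a 3-row coordinate instance to its
dominance matrix M' i j := [∀ k<3, M k j ≤ M k i] (polynomial-time transducer over
`encodingNatMatrix`), so an FPRAS for #IDEALS composed with it is an FPRAS at dimension 3 (FP closed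
under composition; the coin/accuracy suffix of `countQuery` is passed through). Routine TM plumbing;
the shared lemma 'FPRAS pulls back along an exactly count-preserving FP map' should be proved once
with --supports and reused by IdealsReduceToBIS / DimSixtyFourBISHard. -/
@[route_item "route-PneNP-BISOrderDimension"]
def DimThreeToIdeals : Prop :=
  DimThreeNoFPRAS → IdealsNoFPRAS

/-- item stmt-PneNP-2097 · support · rank 9 · open · by planner
sources: CaiEtAl2016, Cor. 3 (lit paper:arxiv-1311.4451 p. 5), FurediKahn1986 (context: dim of bounded-degree orders; Rödl–Trotter 2k²+2), DyerEtAl2003 (AP-reductions compose)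
[support] Top-of-dial calibration with the printed theorem as EXPLICIT HYPOTHESIS: (CaiEtAl2016 Cor.
3 at λ=1, Δ=6, i.e. an FPRAS for #BIS on 2-colourable graphs all of whose degrees are ≤ 6 yields an
FPRAS for #BIS) → (FPRAS for down-sets of 64-dimensional orders) → FPRAS for #BIS. Proof: for a
bipartite G = (A,B;E) with max degree k the height-2 order P_G (a < b iff ab ∈ E) has
#down-sets(P_G) = #IS(G) and an EXPLICIT realizer of size 2k²−2k+4: the two extensions 'A then B'
forwards/backwards, and for each colour class A_i of a greedy proper colouring of the square graph
on A (≤ k(k−1)+1 classes; every b has ≤ 1 neighbour in A_i) the extension 'A∖A_i, B_0, a_1, B_1, …,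
a_r, B_r' (B_j = the b whose A_i-neighbour is a_j) and its A_i-reversal — every non-edge (a,b), a ∈
A_i, is inverted in one of the two. k = 6 gives 64 coordinate rows, computable in polynomial time
(graphs with < 64 vertices: count exactly). FurediKahn1986 (dim < c·k·log²k, probabilistic) gave the
card's D₀ < 2100; the explicit bound is what an AP-reduction needs. -/
@[route_item "route-PneNP-BISOrderDimension"]
def DimSixtyFourBISHard : Prop :=
  ((∃ F ∈ Literature.Computability.Complexity.FP, ∃ c : Polynomial ℕ, ∀ (x : List Bool) (kη kδ : ℕ), 0 < kη → 0 < kδ → Literature.Computability.Complexity.uniformProb (c.eval (x.length + kη + kδ)) {u | ¬ Literature.Computability.Complexity.IsApproxCount kη ((fun y : List Bool => (Literature.Computability.Complexity.encodingGraph.decode y).elim 0 fun G => Set.ncard {S : Finset (Fin G.1) | G.2.Colorable 2 ∧ (∀ v : Fin G.1, Set.ncard {w : Fin G.1 | G.2.Adj v w} ≤ 6) ∧ ∀ a ∈ S, ∀ b ∈ S, ¬ G.2.Adj a b}) x) (Literature.Computability.Complexity.countEstimate F x 0 kη kδ u)} ≤ 1 / (kδ : ℝ)) → (∃ F ∈ Literature.Computability.Complexity.FP,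 ∃ c : Polynomial ℕ, ∀ (x : List Bool) (kη kδ : ℕ), 0 < kη → 0 < kδ → Literature.Computability.Complexity.uniformProb (c.eval (x.length + kη + kδ)) {u | ¬ Literature.Computability.Complexity.IsApproxCount kη ((fun y : List Bool => (Literature.Computability.Complexity.encodingGraph.decode y).elim 0 fun G => Set.ncard {S : Finset (Fin G.1) | G.2.Colorable 2 ∧ ∀ a ∈ S, ∀ b ∈ S, ¬ G.2.Adj a b}) x) (Literature.Computability.Complexity.countEstimate F x 0 kη kδ u)} ≤ 1 / (kδ : ℝ))) → (∃ F ∈ Literature.Computability.Complexity.FP, ∃ c : Polynomial ℕ, ∀ (x : List Bool) (kη kδ : ℕ), 0 < kη → 0 < kδ → Literature.Computability.Complexity.uniformProb (c.eval (x.length + kη + kδ)) {u | ¬ Literature.Computability.Complexity.IsApproxCount kη ((fun y : List Bool => (Literature.Computability.Complexity.encodingNatMatrix.decode y).elim 0 fun p => Set.ncard {I : Finset (Fin p.1) | ∀ i ∈ I, ∀ j : Fin p.1, (∀ k : Fin p.1, k.val < 64 → p.2 k j ≤ p.2 k i) → j ∈ I}) x) (Literature.Computability.Complexity.countEstimate F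 x 0 kη kδ u)} ≤ 1 / (kδ : ℝ)) → (∃ F ∈ Literature.Computability.Complexity.FP, ∃ c : Polynomial ℕ, ∀ (x : List Bool) (kη kδ : ℕ), 0 < kη → 0 < kδ → Literature.Computability.Complexity.uniformProb (c.eval (x.length + kη + kδ)) {u | ¬ Literature.Computability.Complexity.IsApproxCount kη ((fun y : List Bool => (Literature.Computability.Complexity.encodingGraph.decode y).elim 0 fun G => Set.ncard {S : Finset (Fin G.1) | G.2.Colorable 2 ∧ ∀ a ∈ S, ∀ b ∈ S, ¬ G.2.Adj a b}) x) (Literature.Computability.Complexity.countEstimate F x 0 kη kδ u)} ≤ 1 / (kδ : ℝ))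

/-- item stmt-PneNP-2135 · support · rank 9 · open · by planner
[support] Exact calibration at the bottom of the dial: computing the number of down-sets of a
3-dimensional order (input: 3 coordinate rows, as in DimThreeNoFPRAS) EXACTLY is #P-hard under Cook
reductions — intended signature once the two printed theorems below are vendored as named facts:
`Literature.Computability.Complexity.IsSharpPHardFun <the dim-3 count of DimThreeNoFPRAS>` (left
informal because the bare item type could not be closed without them; a grounder/librarian may set
the signature with the facts as explicit hypotheses). Proof sketch: for a planar (multi)graph G the
vertex–edge incidence poset P_G has dimension ≤ 3 with a polynomial-time Schnyder-wood realizer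
(Schnyder1989; ChaplickEtAl2018 Thm 1); antichains of P_G = independent sets of the subdivision of
G, counted by Σ_{U ⊆ V} 2^{e(G[U])} = Z_{β=1,γ=2,λ=1}(G), i.e. Pl-Hol_3(1,2), which is #P-hard on
planar 3-regular graphs (CaiKowalczyk2012, as quoted in GoldbergJerrumMcquillan2015 §1.1: planar
k-regular two-spin is #P-hard unless ab=1, a=b=0 or a=b). Contrast: the same quantity has an FPRAS
for ALL graphs (GoldbergJerrumPaterson2003, ferromagnetic with β ≤ γ, λ ≥ √(β/γ)), so exact hardness
at d=3 says nothing abo -/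
@[route_item "route-PneNP-BISOrderDimension"]
def DimThreeExactSharpPHard : Prop :=
  Literature.Computability.Complexity.IsSharpPHardFun (fun y : List Bool => (Literature.Computability.Complexity.encodingNatMatrix.decode y).elim 0 fun p => Set.ncard {I : Finset (Fin p.1) | ∀ i ∈ I, ∀ j : Fin p.1, (∀ k : Fin p.1, k.val < 3 → p.2 k j ≤ p.2 k i) → j ∈ I})

/-- item stmt-PneNP-2098 · assembly · rank 1 · closed · proved by Summit.PneNP.PneNP.Theorems.bisOrderDimension_assembly_proof @ 246ddfe63677 (prover) · by planner
sources: Stockmeyer1985; Literature.Computability.Complexity.StockMachine.stockmeyerApproxCounting_holds (StockmeyerMachines.lean:770), Literature.Computability.Complexity.NPRel_empty, FPRel_subset_FP_of_mem_FP (OracleEmpty*.lean); Literature.Computability.Cryptography.pneNP_shape_of_NP_not_subset_P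
[assembly] IdealsNoFPRAS → PneNP. If NP ⊆ P: the witness relation R = {boolPair x y : y ∈ {0,1}^n is
the indicator vector of an implication-closed subset of the n×n matrix decoded from x} is in P (one
transducer over `encodingNatMatrix`, cf. the Karp verifiers KarpClique*/MaxCut* in
Literature/Computability/Complexity) and countWitnesses R n x = #IDEALS(x);
`StockMachine.stockmeyerApproxCounting_holds` at `Oracle.empty` gives L ∈ NPRel ∅ = NP
(`NPRel_empty`) ⊆ P and F ∈ FPRel (Oracle.ofLanguage L) ⊆ FP (`FPRel_subset_FP_of_mem_FP` once
`Oracle.ofLanguage L ∈ FP`, from L ∈ P); precomposing F with (x,kη,kδ,u) ↦ countQuery x n kη kδ u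
(FP, composition) is exactly the FPRAS the target denies. Hence ¬(NP ⊆ P), i.e. PneNP by
`Literature.Computability.Cryptography.pneNP_shape_of_NP_not_subset_P` (P_bool_eq_holds,
NP_bool_eq_holds). Every named fact used is PROVED in the tree; the new work is the verifier machine
and FP-composition plumbing. -/
@[route_item "route-PneNP-BISOrderDimension", crux]
def Assembly : Prop :=
  IdealsNoFPRAS → PneNP

/-! D-0027 §2.1 — DECIDING THEOREM (planner-authored via `route open/edit --closes-file`; by planner-rbadge-PneNP-BISOrderDimension-8febd0af-g2-0 2026-08-15T16:17:26Z):
its hypotheses are this route's items and its conclusion the sub-problem Statement (glue_lint), and it elaborates with this file. -/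

@[closes "route-PneNP-BISOrderDimension"] theorem closes (hX : IdealsNoFPRAS) (hA : Assembly) : _root_.PneNP :=
  hA hX

end Summit.PneNP.PneNP.Theses.BISOrderDimension
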